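import Literature.Computability.QuantumComplexity.PseudoBounded
import Literature.Computability.QuantumComplexity.InfluenceBounds
import Literature.Computability.Complexity.BooleanFourier

/-!
# Route `SosSandwich`: a bounded ANTIPODAL cubic that is NOT pseudo-bounded of order 2

The gate-aa-sos VERDICT (HOME/STATUS.md) named as its cheap falsifier the inclusion
«every `[0,1]`-bounded `p` with `p(¬x) = 1 - p(x)` and `deg p ≤ 2T - 1` is pseudo-bounded of order `T`»
(true for `T = 1`). This file refutes it for `T = 2` in the kernel, with the least possible number of
variables (`N = 4`; for `N ≤ 3` the inclusion holds): the self-dual Boolean function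
`f(y₀,y₁,y₂,y₃) = if y₃ then y₀ ∧ y₁ ∧ y₂ else y₀ ∨ y₁ ∨ y₂` (the weighted majority `MAJ₅(y₀,y₁,y₂,¬y₃,¬y₃)`),
a multilinear polynomial of total degree `3`, is `{0,1}`-valued and antipodal, but `1 - f` is not a sum
of squares of polynomials of total degree `≤ 2` on the cube: on the face `y₃ = 0` it is the point
indicator `[y₀ = y₁ = y₂ = 0]`, so every `r_j` of a would-be certificate vanishes at the seven other
points of that face, and a polynomial of total degree `≤ 2` has vanishing Walsh coefficients at
`{0,1,2}` and `{0,1,2,3}`, which forces `r_j(0) = 0` as well — contradiction at `y = 0`.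
The same argument shows, for every odd `k ≥ 3`, that `y_k ? AND_k : OR_k` on `k + 1` bits (antipodal,
degree `k`) is not pseudo-bounded of order `k - 1 ≥ (k+1)/2`; so the inclusion fails at `N = 2T` for
every `T ≥ 2` (pen-and-paper; only `T = 2` is formalised here).
-/

set_option linter.dupNamespace false -- D-0017: single-problem summit ⇒ `QuantumAdvantage.QuantumAdvantage` by design

namespace Summit.QuantumAdvantage.QuantumAdvantage.Theorems.SosSandwich

open Finset MvPolynomial Literature.Computability.QuantumComplexity
  Literature.Computability.Complexity.LowDegree Literature.Probability.RandomGraphs.LowDegree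

/-! ### A Walsh-coefficient lemma: low degree + vanishing on a face minus a point ⇒ vanishing at the point -/

/-- A Walsh character never vanishes (`χ_S(x) = ±1`). [folklore] -/
theorem walsh_ne_zero {N : ℕ} (S : Finset (Fin N)) (x : Fin N → Bool) : walsh S x ≠ 0 := by
  unfold walsh
  exact Finset.prod_ne_zero_iff.mpr fun j _ => by cases x j <;> simp [sgn]

/-- If `r` has total degree `≤ N - 2` (stated as `r.totalDegree + 2 ≤ N`) and, on the face
`{x i = false}`, its cube-evaluation vanishes everywhere except possibly at one point `a` of that face,
then it vanishes at `a` too: the Walsh coefficients of `r` at `univ.erase i` and at `univ` both vanish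
(degree), and their sum is twice the face sum `Σ_{x i = false} r(x) χ(x) = r(a) χ(a)`. In particular a
point indicator on a `d`-dimensional face has no sum-of-squares certificate of degree `< d`. [folklore] -/
theorem evalBool_eq_zero_of_vanish_on_face {N : ℕ} (i : Fin N) (r : MvPolynomial (Fin N) ℝ)
    (hr : r.totalDegree + 2 ≤ N) (a : Fin N → Bool) (ha : a i = false)
    (h0 : ∀ x : Fin N → Bool, x i = false → x ≠ a → evalBool r x = 0) :
    evalBool r a = 0 := by
  classical
  set S : Finset (Fin N) := Finset.univ.erase i with hS
  have hi : i ∈ (Finset.univ : Finset (Fin N)) := Finset.mem_univ i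
  have hScard : S.card = N - 1 := by
    rw [hS, Finset.card_erase_of_mem hi, Finset.card_univ, Fintype.card_fin]
  have hA : cubeFourierCoeff (evalBool r) S = 0 :=
    cubeFourierCoeff_evalBool_eq_zero (le_refl r.totalDegree) (by rw [hScard]; omega)
  have hB : cubeFourierCoeff (evalBool r) Finset.univ = 0 :=
    cubeFourierCoeff_evalBool_eq_zero (le_refl r.totalDegree)
      (by rw [Finset.card_univ, Fintype.card_fin]; omega)
  have h2 : (2 : ℝ) ^ N ≠ 0 := pow_ne_zero _ two_ne_zero
  unfold cubeFourierCoeff at hA hB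
  rw [div_eq_zero_iff, or_iff_left h2] at hA hB
  -- χ_univ = χ_S · sgn(x i)
  have hsplit : ∀ x : Fin N → Bool, walsh Finset.univ x = walsh S x * sgn (x i) := by
    intro x; unfold walsh; rw [hS, Finset.prod_erase_mul _ _ hi]
  have hsum : ∑ x : Fin N → Bool, evalBool r x * walsh S x * (1 + sgn (x i)) = 0 := by
    have : ∑ x : Fin N → Bool, evalBool r x * walsh S x * (1 + sgn (x i)) =
        (∑ x : Fin N → Bool, evalBool r x * walsh S x) +
          ∑ x : Fin N → Bool, evalBool r x * walsh Finset.univ x := by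
      rw [← Finset.sum_add_distrib]
      refine Finset.sum_congr rfl fun x _ => ?_
      rw [hsplit x]; ring
    rw [this, hA, hB, add_zero]
  -- only the point `a` contributes, with weight 2
  have hsingle : ∑ x : Fin N → Bool, evalBool r x * walsh S x * (1 + sgn (x i)) =
      evalBool r a * walsh S a * 2 := by
    rw [Fintype.sum_eq_single a]
    · rw [ha]; norm_num
    · intro x hx
      cases hxi : x i
      · rw [h0 x hxi hx]; ring
      · simp [sgn]
  rw [hsingle] at hsum
  have hw := walsh_ne_zero S a
  have : evalBool r a * walsh S a = 0 := by linarith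
  rcases mul_eq_zero.mp this with h | h
  · exact h
  · exact absurd h hw

/-! ### The witness `f = (y₃ ? AND : OR)(y₀,y₁,y₂)` as a degree-3 polynomial -/

/-- **The antipodal inclusion fails at order 2 (route `SosSandwich`, gate-aa-sos verdict, 'disprover-wanted').**
There is a polynomial on 4 Boolean variables of total degree `≤ 3 = 2·2 - 1` that is `{0,1}`-valued
(hence `[0,1]`-bounded) and ANTIPODAL (`f(¬x) = 1 - f(x)`) on the cube, and is NOT pseudo-bounded of
order `2` (Kaniewski–Lee–de Wolf: the sos-degree of `1 - f` is `3`). Witness: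
`f = y₀+y₁+y₂ - y₀y₁ - y₀y₂ - y₁y₂ + y₀y₁y₂ - y₃(y₀+y₁+y₂) + y₃(y₀y₁+y₀y₂+y₁y₂)`, the multilinear form of
`if y₃ then AND(y₀,y₁,y₂) else OR(y₀,y₁,y₂)` (= `MAJ₅(y₀,y₁,y₂,¬y₃,¬y₃)`). Proof of non-membership: on the
face `y₃ = 0`, `1 - f = [y = 0]`; each `r_j` of a degree-`≤ 2` certificate `1 - f = Σ r_j²` vanishes at the
other seven points of the face, hence (`evalBool_eq_zero_of_vanish_on_face`) at `0` — but `1 - f(0) = 1`.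
So «bounded ∧ antipodal ∧ deg ≤ 2T−1 ⟹ K_T» is false for `T = 2` (true for `T = 1`), and
`PB-AA(T) ⟹ AA_odd(2T−1)` is not a corollary of any such inclusion. [folklore] -/
theorem exists_antipodal_cubic_not_pseudoBounded_two :
    ∃ p : MvPolynomial (Fin 4) ℝ, p.totalDegree ≤ 3 ∧
      (∀ x : Fin 4 → Bool, MvPolynomial.eval (fun k => if x k then (1 : ℝ) else 0) p = 0 ∨
        MvPolynomial.eval (fun k => if x k then (1 : ℝ) else 0) p = 1) ∧
      (∀ x : Fin 4 → Bool, 0 ≤ MvPolynomial.eval (fun k => if x k then (1 : ℝ) else 0) p ∧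
        MvPolynomial.eval (fun k => if x k then (1 : ℝ) else 0) p ≤ 1) ∧
      (∀ x : Fin 4 → Bool, MvPolynomial.eval (fun k => if (!x k) then (1 : ℝ) else 0) p =
        1 - MvPolynomial.eval (fun k => if x k then (1 : ℝ) else 0) p) ∧
      ¬ PseudoBounded 2 p := by
  set f : MvPolynomial (Fin 4) ℝ :=
    (X 0 + X 1 + X 2) - (X 0 * X 1 + X 0 * X 2 + X 1 * X 2) + X 0 * X 1 * X 2
      - X 3 * (X 0 + X 1 + X 2) + X 3 * (X 0 * X 1 + X 0 * X 2 + X 1 * X 2) with hf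
  -- the value at a cube point, as explicit arithmetic in the four bits
  have heval : ∀ x : Fin 4 → Bool, MvPolynomial.eval (fun k => if x k then (1 : ℝ) else 0) f =
      ((if x 0 then (1 : ℝ) else 0) + (if x 1 then 1 else 0) + (if x 2 then 1 else 0))
        - ((if x 0 then (1 : ℝ) else 0) * (if x 1 then 1 else 0) + (if x 0 then (1 : ℝ) else 0) * (if x 2 then 1 else 0)
            + (if x 1 then (1 : ℝ) else 0) * (if x 2 then 1 else 0))
        + (if x 0 then (1 : ℝ) else 0) * (if x 1 then 1 else 0) * (if x 2 then 1 else 0)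
        - (if x 3 then (1 : ℝ) else 0) * ((if x 0 then (1 : ℝ) else 0) + (if x 1 then 1 else 0) + (if x 2 then 1 else 0))
        + (if x 3 then (1 : ℝ) else 0) * ((if x 0 then (1 : ℝ) else 0) * (if x 1 then 1 else 0)
            + (if x 0 then (1 : ℝ) else 0) * (if x 2 then 1 else 0) + (if x 1 then (1 : ℝ) else 0) * (if x 2 then 1 else 0)) := by
    intro x
    simp only [hf, map_add, map_sub, map_mul, MvPolynomial.eval_X]
  -- Boolean-valued
  have hbool : ∀ x : Fin 4 → Bool, MvPolynomial.eval (fun k => if x k then (1 : ℝ) else 0) f = 0 ∨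
      MvPolynomial.eval (fun k => if x k then (1 : ℝ) else 0) f = 1 := by
    intro x; rw [heval]
    cases x 0 <;> cases x 1 <;> cases x 2 <;> cases x 3 <;> norm_num
  -- the face `y₃ = 0` away from the origin: `f = OR = 1`; the origin: `f = 0`
  have hface : ∀ x : Fin 4 → Bool, x 3 = false → x ≠ (fun _ => false) →
      MvPolynomial.eval (fun k => if x k then (1 : ℝ) else 0) f = 1 := by
    intro x h3 hx
    have hne : ¬ (x 0 = false ∧ x 1 = false ∧ x 2 = false) := by
      rintro ⟨h0, h1, h2⟩
      apply hx
      funext k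
      fin_cases k <;> simp [h0, h1, h2, h3]
    rw [heval]
    cases h0 : x 0 <;> cases h1 : x 1 <;> cases h2 : x 2 <;> simp [h0, h1, h2, h3] at hne ⊢
  have horigin : MvPolynomial.eval (fun k => if (fun _ : Fin 4 => false) k then (1 : ℝ) else 0) f = 0 := by
    rw [heval]; norm_num
  refine ⟨f, ?_, hbool, ?_, ?_, ?_⟩
  · -- total degree ≤ 3
    have hX : ∀ i : Fin 4, (X i : MvPolynomial (Fin 4) ℝ).totalDegree ≤ 1 := fun i =>
      (totalDegree_X (R := ℝ) i).le
    have hXX : ∀ i j : Fin 4, (X i * X j : MvPolynomial (Fin 4) ℝ).totalDegree ≤ 2 := fun i j =>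
      (totalDegree_mul _ _).trans (by have := hX i; have := hX j; omega)
    have hXXX : (X 0 * X 1 * X 2 : MvPolynomial (Fin 4) ℝ).totalDegree ≤ 3 :=
      (totalDegree_mul _ _).trans (by have := hXX 0 1; have := hX 2; omega)
    have hL : (X 0 + X 1 + X 2 : MvPolynomial (Fin 4) ℝ).totalDegree ≤ 1 :=
      (totalDegree_add _ _).trans (max_le ((totalDegree_add _ _).trans (max_le (hX 0) (hX 1))) (hX 2))
    have hQ : (X 0 * X 1 + X 0 * X 2 + X 1 * X 2 : MvPolynomial (Fin 4) ℝ).totalDegree ≤ 2 :=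
      (totalDegree_add _ _).trans
        (max_le ((totalDegree_add _ _).trans (max_le (hXX 0 1) (hXX 0 2))) (hXX 1 2))
    have h3L : (X 3 * (X 0 + X 1 + X 2) : MvPolynomial (Fin 4) ℝ).totalDegree ≤ 2 :=
      (totalDegree_mul _ _).trans (by have := hX 3; omega)
    have h3Q : (X 3 * (X 0 * X 1 + X 0 * X 2 + X 1 * X 2) : MvPolynomial (Fin 4) ℝ).totalDegree ≤ 3 :=
      (totalDegree_mul _ _).trans (by have := hX 3; omega)
    rw [hf]
    refine (totalDegree_add _ _).trans (max_le ?_ h3Q)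
    refine (totalDegree_sub _ _).trans (max_le ?_ (h3L.trans (by norm_num)))
    refine (totalDegree_add _ _).trans (max_le ?_ hXXX)
    exact (totalDegree_sub _ _).trans (max_le (hL.trans (by norm_num)) (hQ.trans (by norm_num)))
  · -- bounded
    intro x
    rcases hbool x with h | h <;> rw [h] <;> norm_num
  · -- antipodal
    intro x
    rw [heval (fun k => !x k), heval x]
    cases x 0 <;> cases x 1 <;> cases x 2 <;> cases x 3 <;> norm_num
  · -- not pseudo-bounded of order 2
    rintro ⟨m, q, r, hdeg, hval⟩
    have hvan : ∀ j, ∀ x : Fin 4 → Bool, x 3 = false → x ≠ (fun _ => false) →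
        evalBool (r j) x = 0 := by
      intro j x h3 hx
      have h1 := (hval x).2
      rw [hface x h3 hx, sub_self] at h1
      have hz := (Finset.sum_eq_zero_iff_of_nonneg (fun j _ => sq_nonneg _)).mp h1.symm j
        (Finset.mem_univ j)
      exact (pow_eq_zero_iff two_ne_zero).mp hz
    have hzero : ∀ j, evalBool (r j) (fun _ => false) = 0 := fun j =>
      evalBool_eq_zero_of_vanish_on_face 3 (r j) (by have := (hdeg j).2; omega) (fun _ => false) rfl
        (hvan j)
    have h0 := (hval (fun _ => false)).2
    rw [horigin] at h0
    have hsum0 : ∑ j, MvPolynomial.eval (fun k => if (fun _ : Fin 4 => false) k then (1 : ℝ) else 0) (r j) ^ 2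
        = 0 :=
      Finset.sum_eq_zero fun j _ => by
        have := hzero j; unfold evalBool at this; rw [this]; ring
    linarith

/-! ### All orders: the selector `y_k ? AND_k : OR_k` on `k + 1` bits, `k` odd -/

/-- Evaluation of an inclusion–exclusion polynomial `Σ_{S ∈ U} (-1)^{|S|+1} y_S` at a cube point: only the
sets `S` inside the support `{i : x_i = 1}` contribute. [folklore] -/
theorem eval_inclExcl {k : ℕ} (U : Finset (Finset (Fin k))) (x : Fin (k + 1) → Bool) :
    MvPolynomial.eval (fun j => if x j then (1 : ℝ) else 0)
        (∑ S ∈ U, C ((-1 : ℝ) ^ (S.card + 1)) * ∏ i ∈ S, X (Fin.castSucc i)) =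
      ∑ S ∈ U with S ⊆ Finset.univ.filter (fun i => x (Fin.castSucc i) = true),
        (-1 : ℝ) ^ (S.card + 1) := by
  rw [map_sum, Finset.sum_filter]
  refine Finset.sum_congr rfl fun S _ => ?_
  rw [map_mul, MvPolynomial.eval_C, map_prod]; simp only [MvPolynomial.eval_X]; rw [Finset.prod_boole]
  have hiff : (∀ i ∈ S, x (Fin.castSucc i) = true) ↔
      S ⊆ Finset.univ.filter (fun i => x (Fin.castSucc i) = true) := by
    simp [Finset.subset_iff]
  by_cases h : ∀ i ∈ S, x (Fin.castSucc i) = true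
  · rw [if_pos h, if_pos (hiff.mp h), mul_one]
  · rw [if_neg h, if_neg (fun h' => h (hiff.mpr h')), mul_zero]

/-- `Σ_{S ⊆ A} (-1)^{|S|+1} = -[A = ∅]` (binomial alternating sum). [folklore] -/
theorem sum_powerset_neg_one_pow_card_succ {k : ℕ} (A : Finset (Fin k)) :
    ∑ S ∈ A.powerset, (-1 : ℝ) ^ (S.card + 1) = if A = ∅ then -1 else 0 := by
  have h := (Finset.sum_powerset_neg_one_pow_card (x := A))
  have h' : ∑ S ∈ A.powerset, (-1 : ℝ) ^ S.card = if A = ∅ then 1 else 0 := by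
    have := congrArg (fun z : ℤ => (z : ℝ)) h
    push_cast at this
    simpa using this
  have : ∑ S ∈ A.powerset, (-1 : ℝ) ^ (S.card + 1) = -∑ S ∈ A.powerset, (-1 : ℝ) ^ S.card := by
    rw [← Finset.sum_neg_distrib]
    exact Finset.sum_congr rfl fun S _ => by ring
  rw [this, h']; split_ifs <;> norm_num

/-- The nonempty subsets of `univ` inside `A` are the nonempty subsets of `A`. [folklore] -/
theorem filter_subset_powerset_erase_empty {k : ℕ} (A : Finset (Fin k)) :
    ((Finset.univ : Finset (Fin k)).powerset.erase ∅).filter (fun S => S ⊆ A) = A.powerset.erase ∅ := by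
  ext S
  simp only [Finset.mem_filter, Finset.mem_erase, Finset.mem_powerset]
  exact ⟨fun ⟨⟨hne, _⟩, hsub⟩ => ⟨hne, hsub⟩, fun ⟨hne, hsub⟩ => ⟨⟨hne, Finset.subset_univ _⟩, hsub⟩⟩

/-- **The antipodal inclusion fails at every order.** For every odd `k ≥ 1` there is a polynomial on `k + 1`
Boolean variables of total degree `≤ k`, `{0,1}`-valued and antipodal on the cube, that is NOT pseudo-bounded
of order `k - 1`: the self-dual selector `f(y, b) = if b then AND_k(y) else OR_k(y)`, written as
`OR_k - X_b · D` with `OR_k = Σ_{∅≠S} (-1)^{|S|+1} y_S`, `D = Σ_{∅≠S≠[k]} (-1)^{|S|+1} y_S` (`= OR_k - AND_k`, `k`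
odd). On the face `b = 0`, `1 - f` is the indicator of the origin, of sum-of-squares degree `k`
(`evalBool_eq_zero_of_vanish_on_face`). [folklore] -/
theorem exists_antipodal_not_pseudoBounded (k : ℕ) (hk : Odd k) :
    ∃ p : MvPolynomial (Fin (k + 1)) ℝ, p.totalDegree ≤ k ∧
      (∀ x : Fin (k + 1) → Bool, MvPolynomial.eval (fun j => if x j then (1 : ℝ) else 0) p = 0 ∨
        MvPolynomial.eval (fun j => if x j then (1 : ℝ) else 0) p = 1) ∧
      (∀ x : Fin (k + 1) → Bool, MvPolynomial.eval (fun j => if (!x j) then (1 : ℝ) else 0) p =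
        1 - MvPolynomial.eval (fun j => if x j then (1 : ℝ) else 0) p) ∧
      ¬ PseudoBounded (k - 1) p := by
  classical
  have hk1 : 1 ≤ k := by obtain ⟨j, rfl⟩ := hk; omega
  set UO : Finset (Finset (Fin k)) := (Finset.univ : Finset (Fin k)).powerset.erase ∅ with hUO
  set UD : Finset (Finset (Fin k)) := UO.erase Finset.univ with hUD
  set ORp : MvPolynomial (Fin (k + 1)) ℝ :=
    ∑ S ∈ UO, C ((-1 : ℝ) ^ (S.card + 1)) * ∏ i ∈ S, X (Fin.castSucc i) with hORp
  set Dp : MvPolynomial (Fin (k + 1)) ℝ :=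
    ∑ S ∈ UD, C ((-1 : ℝ) ^ (S.card + 1)) * ∏ i ∈ S, X (Fin.castSucc i) with hDp
  set f : MvPolynomial (Fin (k + 1)) ℝ := ORp - X (Fin.last k) * Dp with hf
  let A : (Fin (k + 1) → Bool) → Finset (Fin k) :=
    fun x => Finset.univ.filter (fun i => x (Fin.castSucc i) = true)
  have hevOR : ∀ x : Fin (k + 1) → Bool,
      MvPolynomial.eval (fun j => if x j then (1 : ℝ) else 0) ORp = if A x = ∅ then 0 else 1 := by
    intro x; rw [hORp, eval_inclExcl, hUO, filter_subset_powerset_erase_empty]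
    have hmem : (∅ : Finset (Fin k)) ∈ (A x).powerset := Finset.empty_mem_powerset _
    have := Finset.sum_erase_add _ (fun S : Finset (Fin k) => (-1 : ℝ) ^ (S.card + 1)) hmem
    rw [sum_powerset_neg_one_pow_card_succ] at this
    simp only [Finset.card_empty, zero_add, pow_one] at this
    split_ifs at this with h
    · rw [if_pos h]; linarith
    rw [if_neg h]; linarith
  have hunivne : (Finset.univ : Finset (Fin k)) ≠ ∅ := by
    rw [← Finset.nonempty_iff_ne_empty]
    exact ⟨⟨0, by omega⟩, Finset.mem_univ _⟩
  have hevD : ∀ x : Fin (k + 1) → Bool,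
      MvPolynomial.eval (fun j => if x j then (1 : ℝ) else 0) Dp =
        (if A x = ∅ then 0 else 1) - (if A x = Finset.univ then 1 else 0) := by
    intro x
    rw [← hevOR x, hDp, hORp, eval_inclExcl, eval_inclExcl, hUD, Finset.filter_erase]
    by_cases hAu : A x = Finset.univ
    · have hmem : (Finset.univ : Finset (Fin k)) ∈ UO.filter (fun S => S ⊆ A x) := by
        rw [Finset.mem_filter, hUO, Finset.mem_erase]
        exact ⟨⟨hunivne, Finset.mem_powerset.mpr (subset_refl _)⟩, by rw [hAu]⟩
      rw [Finset.sum_erase_eq_sub hmem, if_pos hAu, Finset.card_univ, Fintype.card_fin]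
      have : (-1 : ℝ) ^ (k + 1) = 1 := Even.neg_one_pow (by obtain ⟨j, rfl⟩ := hk; exact ⟨j + 1, by ring⟩)
      rw [this]
    · have hnmem : (Finset.univ : Finset (Fin k)) ∉ UO.filter (fun S => S ⊆ A x) := by
        rw [Finset.mem_filter]
        rintro ⟨-, hsub⟩
        exact hAu (Finset.eq_univ_of_forall fun i => by
          have := hsub (Finset.mem_univ i); exact this)
      rw [Finset.erase_eq_of_notMem hnmem, if_neg hAu, sub_zero]
  have hev : ∀ x : Fin (k + 1) → Bool, MvPolynomial.eval (fun j => if x j then (1 : ℝ) else 0) f =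
      (if A x = ∅ then 0 else 1) - (if x (Fin.last k) then (1 : ℝ) else 0) *
        ((if A x = ∅ then 0 else 1) - (if A x = Finset.univ then 1 else 0)) := by
    intro x; rw [hf, map_sub, map_mul, MvPolynomial.eval_X, hevOR, hevD]
  have hAne_of_univ : ∀ x, A x = Finset.univ → A x ≠ ∅ := fun x h => by rw [h]; exact hunivne
  -- Boolean-valued
  have hbool : ∀ x : Fin (k + 1) → Bool, MvPolynomial.eval (fun j => if x j then (1 : ℝ) else 0) f = 0 ∨
      MvPolynomial.eval (fun j => if x j then (1 : ℝ) else 0) f = 1 := by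
    intro x; rw [hev]
    by_cases h0 : A x = ∅
    · have hu : A x ≠ Finset.univ := fun hu => hAne_of_univ x hu h0
      rw [if_pos h0, if_neg hu]; cases x (Fin.last k) <;> simp
    · by_cases hu : A x = Finset.univ
      · rw [if_neg h0, if_pos hu]; cases x (Fin.last k) <;> simp
      · rw [if_neg h0, if_neg hu]; cases x (Fin.last k) <;> simp
  -- complement swaps `A = ∅` and `A = univ`
  have hAcompl_empty : ∀ x : Fin (k + 1) → Bool, (A (fun j => !x j) = ∅ ↔ A x = Finset.univ) := by
    intro x
    simp only [A, Finset.filter_eq_empty_iff, Finset.mem_univ, true_implies,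
      Finset.eq_univ_iff_forall, Finset.mem_filter, true_and, Bool.not_eq_true', Bool.not_eq_false]
  have hAcompl_univ : ∀ x : Fin (k + 1) → Bool, (A (fun j => !x j) = Finset.univ ↔ A x = ∅) := by
    intro x
    have := hAcompl_empty (fun j => !x j)
    simp only [Bool.not_not] at this
    exact this.symm
  refine ⟨f, ?_, hbool, ?_, ?_⟩
  · -- total degree ≤ k
    have hterm : ∀ S : Finset (Fin k),
        (C ((-1 : ℝ) ^ (S.card + 1)) * ∏ i ∈ S, X (Fin.castSucc i) :
          MvPolynomial (Fin (k + 1)) ℝ).totalDegree ≤ S.card := by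
      intro S
      refine (totalDegree_mul _ _).trans ?_
      rw [totalDegree_C, zero_add]; refine (totalDegree_finsetProd _ _).trans ?_
      have : ∑ i ∈ S, (X (Fin.castSucc i) : MvPolynomial (Fin (k + 1)) ℝ).totalDegree = S.card := by
        simp [totalDegree_X]
      rw [this]
    have hOR : ORp.totalDegree ≤ k := by
      rw [hORp]
      refine totalDegree_finsetSum_le fun S _ => (hterm S).trans ?_
      exact (Finset.card_le_univ S).trans (by rw [Fintype.card_fin])
    have hD : Dp.totalDegree ≤ k - 1 := by
      rw [hDp]
      refine totalDegree_finsetSum_le fun S hS => (hterm S).trans ?_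
      rw [hUD, Finset.mem_erase] at hS
      have hne : S ≠ Finset.univ := hS.1
      have hle : S.card ≤ k := (Finset.card_le_univ S).trans (by rw [Fintype.card_fin])
      have hneq : S.card ≠ k := fun h => hne ((Finset.card_eq_iff_eq_univ S).mp (by rw [h, Fintype.card_fin]))
      omega
    rw [hf]
    exact (totalDegree_sub _ _).trans (max_le hOR ((totalDegree_mul _ _).trans (by rw [totalDegree_X]; omega)))
  · -- antipodal
    intro x
    rw [hev (fun j => !x j), hev x]
    have e1 := hAcompl_empty x; have e2 := hAcompl_univ x
    by_cases h0 : A x = ∅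
    · have hu : A x ≠ Finset.univ := fun hu => hAne_of_univ x hu h0
      have h0' : A (fun j => !x j) = Finset.univ := e2.mpr h0
      have hu' : A (fun j => !x j) ≠ ∅ := fun h => hu (e1.mp h)
      rw [if_pos h0, if_neg hu, if_neg hu', if_pos h0']; cases x (Fin.last k) <;> simp
    · by_cases hu : A x = Finset.univ
      · have h0' : A (fun j => !x j) = ∅ := e1.mpr hu
        have hu' : A (fun j => !x j) ≠ Finset.univ := fun h => h0 (e2.mp h)
        rw [if_neg h0, if_pos hu, if_pos h0', if_neg hu']; cases x (Fin.last k) <;> simp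
      · have h0' : A (fun j => !x j) ≠ ∅ := fun h => hu (e1.mp h)
        have hu' : A (fun j => !x j) ≠ Finset.univ := fun h => h0 (e2.mp h)
        rw [if_neg h0, if_neg hu, if_neg h0', if_neg hu']; cases x (Fin.last k) <;> simp
  · -- not pseudo-bounded of order k - 1
    rintro ⟨m, q, r, hdeg, hval⟩
    have hface : ∀ x : Fin (k + 1) → Bool, x (Fin.last k) = false → x ≠ (fun _ => false) →
        MvPolynomial.eval (fun j => if x j then (1 : ℝ) else 0) f = 1 := by
      intro x hl hx
      have hA0 : A x ≠ ∅ := by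
        intro hA
        apply hx
        funext j
        cases Fin.eq_castSucc_or_eq_last j with
        | inl h =>
          obtain ⟨i, rfl⟩ := h
          have : i ∉ A x := by rw [hA]; exact Finset.notMem_empty i
          simpa [A] using this
        | inr h => rw [h]; exact hl
      rw [hev, hl]; simp [hA0]
    have horigin : MvPolynomial.eval (fun j => if (fun _ : Fin (k + 1) => false) j then (1 : ℝ) else 0) f = 0 := by
      have : A (fun _ => false) = ∅ := by simp [A]
      rw [hev]; simp [this]
    have hvan : ∀ j, ∀ x : Fin (k + 1) → Bool, x (Fin.last k) = false → x ≠ (fun _ => false) →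
        evalBool (r j) x = 0 := by
      intro j x hl hx
      have h1 := (hval x).2
      rw [hface x hl hx, sub_self] at h1
      exact (pow_eq_zero_iff two_ne_zero).mp ((Finset.sum_eq_zero_iff_of_nonneg (fun j _ =>
        sq_nonneg _)).mp h1.symm j (Finset.mem_univ j))
    have hzero : ∀ j, evalBool (r j) (fun _ => false) = 0 := fun j =>
      evalBool_eq_zero_of_vanish_on_face (Fin.last k) (r j) (by have := (hdeg j).2; omega)
        (fun _ => false) rfl (hvan j)
    have h0 := (hval (fun _ => false)).2; rw [horigin] at h0
    have hsum0 : ∑ j, MvPolynomial.eval (fun l => if (fun _ : Fin (k + 1) => false) l then (1 : ℝ) else 0) (r j) ^ 2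
        = 0 :=
      Finset.sum_eq_zero fun j _ => by
        have := hzero j; unfold evalBool at this; rw [this]; ring
    linarith

/-- **Corollary (all `T ≥ 2`):** some `{0,1}`-valued antipodal polynomial of total degree `≤ 2T - 1` on `N = 2T`
Boolean variables is not pseudo-bounded of order `T` (not even of order `2T - 2`) — so
«bounded ∧ antipodal ∧ deg ≤ 2T−1 ⟹ K_T» fails for EVERY `T ≥ 2`. [folklore] -/
theorem exists_antipodal_not_pseudoBounded_order (T : ℕ) (hT : 2 ≤ T) :
    ∃ (N : ℕ) (p : MvPolynomial (Fin N) ℝ), p.totalDegree ≤ 2 * T - 1 ∧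
      (∀ x : Fin N → Bool, MvPolynomial.eval (fun j => if x j then (1 : ℝ) else 0) p = 0 ∨
        MvPolynomial.eval (fun j => if x j then (1 : ℝ) else 0) p = 1) ∧
      (∀ x : Fin N → Bool, MvPolynomial.eval (fun j => if (!x j) then (1 : ℝ) else 0) p =
        1 - MvPolynomial.eval (fun j => if x j then (1 : ℝ) else 0) p) ∧
      ¬ PseudoBounded T p := by
  obtain ⟨p, hdeg, hbool, hanti, hnot⟩ :=
    exists_antipodal_not_pseudoBounded (2 * T - 1) ⟨T - 1, by omega⟩
  refine ⟨2 * T - 1 + 1, p, hdeg, hbool, hanti, fun h => hnot (h.mono (by omega))⟩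

end Summit.QuantumAdvantage.QuantumAdvantage.Theorems.SosSandwich
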